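import Literature.Computability.Complexity.LabelCoverToCSP
import Literature.Computability.Complexity.MCSPHardnessFromPCP
import HarnessLib

/-!
# Constant-gap CMMSA from gap label cover, and `MCSP*` from Raz's theorem

Topic `Computability/Complexity`. A second, PCP-lighter front end for the NP-hardness of `MCSP*`
(`isRandNPHard_MCSPStar`, Hirahara FOCS 2022, Thm. 1.2 / Thm. 8.5 of ECCC TR22-119).

Hirahara's proof of Thm. 8.5 (p. 31) combines Thm. 5.2 — NP-hardness of the gap problem CMMSA
with gap `g = Δ(n)^α`, `Δ(n) = (log n)^{1/2}` — with the randomized reduction of Lemma 8.3, and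
concludes from "`s · g ≤ K(y) ≤ O(s' log s')`, which implies `s' ≥ Ω(g) · s / log s`" against the
threshold `s_P = O(s / log s)`: the no-case needs the gap `g` to exceed a universal CONSTANT only
(the growing gap `(log n)^{Ω(1)}` is what the inapproximability clause of Thm. 8.5 and the
learning theorem use). The tree's formalisation of the reduction confirms this: the soundness
theorem `HiraharaRed.card_redOut_mem_mul_three_le` (`HiraharaSpec.lean`) uses of the no-promise
only `g(n) ≥ 107520` and `ε(n) ≤ 1` (`HiraharaRed.Pre.heavy_of_no`). At a constant gap, the PCP
input required by the Dinur–Safra step (`CSPToCMMSA*.lean`; proof of Thm. 5.2) is no longer a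
sliding-scale PCP (`Hirahara2022_lem53_logPow_queried`, soundness `(log n)^{-γ}`) but a `2`-query
projection PCP with a sufficiently small CONSTANT soundness error, i.e. the NP-hardness of gap
LABEL COVER `GAP 2CSP_W(ε)` for every constant `ε > 0` (Arora–Barak 2009, Thm. 22.15: the PCP
theorem with Raz's parallel repetition theorem) — the hypothesis already used, in the same
displayed form, by `AroraEtAl1997_prop6_of_raz` (`GapSetCoverProofs.lean`), and deliberately not
a named fact of the tree (`LabelCover.lean`, module docstring).

## Main results

* `lcDinurSafraMap N₀ W` — the patched Dinur–Safra map (`dinurSafraMap`, `CSPToCMMSAReduction.lean`)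
  on label cover instances (through `LabelCoverInstance.toCSP`, `LabelCoverToCSP.lean`);
  `codeFP_lcDinurSafraMap` — it is polynomial time on codes (`CodeFP`);
* `lcDinurSafraMap_mem_yesSet`, `lcDinurSafraMap_mem_noSet` — for `N₀ ≥ dsThreshold W` it maps
  `GapLabelCover.yesSet W` into `CMMSA.yesSet sqrtLog` and `GapLabelCover.noSet W δ` into
  `CMMSA.noSet g₀ ε₀ sqrtLog` whenever `δ ≤ (ε₀/2) (ε₀/(4 g₀))²` (the Dinur–Safra soundness
  `toCMMSA_mem_noSet` at arity `D = 2` with constant parameters);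
* `isNPHard_gapCMMSA_const_of_gapLabelCover`, `…_of_isNPHard_gapLabelCover`, `…_of_raz` —
  **NP-hardness of `gapCMMSA g₀ ε₀ sqrtLog` for all constants `g₀ ≥ 1`, `0 < ε₀ ≤ 1`** from the
  NP-hardness of gap label cover for every constant soundness error, resp. from Raz's theorem in
  the form of Arora–Barak 2009, Thm. 22.15;
* `isRandNPHard_MCSPStar_of_gapLabelCover`, `isRandNPHard_MCSPStar_of_raz` (and the companions
  `isRandComplete_NP_MCSPStar_of_raz : … → IsRandComplete NP MCSPStar`,
  `NP_subset_BPP_of_MCSPStar_mem_BPP_of_raz`) —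
  `isRandNPHard_MCSPStar` from that hypothesis together with **Lemma 8.3 / Thm. 8.5 at a constant
  gap**: `∃ g₀ ≥ 1, ∃ ε₀ ∈ (0, 1], PromiseRandReducible (gapCMMSA g₀ ε₀ sqrtLog) (ofLanguage MCSP*)`,
  the statement the tree's `HiraharaSpec.lean` establishes on the mathematical side (with
  `g₀ = 107520`), taken here as an explicit hypothesis pending its machine-level completion.

No new named fact is introduced; both hypotheses are displayed statements threaded explicitly,
as in `AroraEtAl1997_prop6_of_raz` and `isRandNPHard_MCSPStar_of_pcp`.

## References

* S. Hirahara, *NP-hardness of learning programs and partial MCSP*, FOCS 2022; ECCC TR22-119: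
  Thm. 5.2 and its proof (pp. 16–18), Lemma 8.3 (p. 26), Thm. 8.5 and its proof (pp. 30–31)
  [Hirahara2022PartialMCSP].
* S. Arora, B. Barak, *Computational Complexity: A Modern Approach*, CUP 2009: Def. 11.11,
  Def. 11.13, §22.3 and Thm. 22.15 (p. 473; PCP theorem with parallel repetition), §7.6
  [AroraBarak2009].
* R. Raz, *A parallel repetition theorem*, SIAM J. Comput. 27 (1998) 763–803, Thm. 1.1.
* I. Dinur, S. Safra, *On the hardness of approximating label-cover*, Inform. Process. Lett. 89
  (2004) 247–254 (the reduction to MMSA reused by Hirahara, proof of Thm. 5.2).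
-/

namespace Literature.Computability.Complexity

open _root_.Computability MetaComplexity

/-! ### The Dinur–Safra map on label cover instances -/

/-- **The patched Dinur–Safra map on label cover instances**: embed the regular projection
instance as an arity-`2` MaxCSP instance (`LabelCoverInstance.toCSP`) and apply `dinurSafraMap N₀ W`
(brute force below `N₀` variables / alphabet `W`, the instance `(Φ, w, s)` of the proof of
Thm. 5.2 above). [cite: Hirahara2022PartialMCSP, proof of Thm. 5.2 (p. 16), from AroraBarak2009, Thm. 22.15 instances] -/
noncomputable def lcDinurSafraMap (N₀ W : ℕ) (φ : LabelCoverInstance) : CMMSAInstance :=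
  dinurSafraMap N₀ W φ.toCSP

/-- **The map is polynomial time on codes** (composition of `codeFP_toCSP` and
`codeFP_dinurSafraMap`). [cite: Hirahara2022PartialMCSP, Thm. 5.2 (proof, p. 16: polynomial-time many-one reduction)] -/
theorem codeFP_lcDinurSafraMap (N₀ W : ℕ) :
    CodeFP LabelCoverInstance.encoding.encode CMMSAInstance.encoding.encode (lcDinurSafraMap N₀ W) :=
  (CSPToCMMSAMachine.codeFP_dinurSafraMap N₀ W).comp LabelCoverToCSPMachine.codeFP_toCSP

/-- The size threshold above which the Dinur–Safra instance is used: `2^{(2W²)²} + W`, so that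
`n > dsThreshold W` gives `W ≤ n` and `2 W² ≤ Δ(n) = ⌊√(log₂ n)⌋` (the degree bound of the
proof of Thm. 5.2, `|Σ|^D · D ≤ Δ`, at `D = 2`). [cite: Hirahara2022PartialMCSP, proof of Thm. 5.2 (p. 18, degree at most Δ)] -/
def dsThreshold (W : ℕ) : ℕ :=
  2 ^ ((W ^ 2 * 2) ^ 2) + W

/-- Above the threshold, `W ≤ n`. [folklore] -/
theorem le_of_dsThreshold_lt {W n : ℕ} (h : dsThreshold W < n) : W ≤ n :=
  ((Nat.le_add_left W _).trans h.le)

/-- Above the threshold, `2 W² ≤ Δ(n)`. [cite: Hirahara2022PartialMCSP, proof of Thm. 5.2 (p. 18)] -/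
theorem pow_two_mul_two_le_sqrtLog {W n : ℕ} (h : dsThreshold W < n) : W ^ 2 * 2 ≤ sqrtLog n := by
  have hpow : 2 ^ ((W ^ 2 * 2) ^ 2) ≤ n := (Nat.le_add_right _ W).trans h.le
  have hlog : (W ^ 2 * 2) ^ 2 ≤ Nat.log 2 n := Nat.le_log_of_pow_le one_lt_two hpow
  rw [sqrtLog, Nat.le_sqrt, ← pow_two]
  exact hlog

section Correctness

variable {W N₀ : ℕ}

/-- **Yes-instances of gap label cover are mapped to yes-instances of CMMSA** (degree bound
`sqrtLog`), for `N₀ ≥ dsThreshold W`. Small instances are decided by brute force; large ones are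
regular, so every variable is queried and `n ≤ 2m` (`numVars_le_totalArity_toCSP`), and
`toCMMSA_mem_yesSet` applies with `W² · 2 ≤ Δ(n)`. [cite: Hirahara2022PartialMCSP, proof of Thm. 5.2 (p. 17, completeness; p. 18, degree)] -/
theorem lcDinurSafraMap_mem_yesSet (hN₀ : dsThreshold W ≤ N₀) {φ : LabelCoverInstance}
    (hφ : φ ∈ GapLabelCover.yesSet W) : lcDinurSafraMap N₀ W φ ∈ CMMSA.yesSet sqrtLog := by
  obtain ⟨hwf, hW, hreg, hsat⟩ := hφ
  have hwf' : φ.toCSP.WellFormed := hwf.toCSP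
  have hsat' : φ.toCSP.IsSatisfiable := (φ.isSatisfiable_toCSP_iff).2 hsat
  unfold lcDinurSafraMap
  by_cases hsmall : φ.numVars ≤ N₀
  · have h : dinurSafraMap N₀ W φ.toCSP = trivialYesCMMSA := by
      unfold dinurSafraMap
      rw [if_pos ⟨hwf', by simpa using hsmall, by simp [hW]⟩, if_pos hsat']
    rw [h]
    exact trivialYesCMMSA_mem_yesSet _
  · push Not at hsmall
    have hlt : dsThreshold W < φ.numVars := lt_of_le_of_lt hN₀ hsmall
    have hnT : φ.toCSP.numVars ≤ φ.toCSP.totalArity := φ.numVars_le_totalArity_toCSP hwf hreg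
    have hfits : φ.toCSP.numVars ≤ φ.toCSP.totalArity ∧ φ.toCSP.alphabetSize ≤ φ.toCSP.totalArity := by
      refine ⟨hnT, le_trans ?_ hnT⟩
      simpa [hW] using le_of_dsThreshold_lt hlt
    have h : dinurSafraMap N₀ W φ.toCSP = φ.toCSP.toCMMSA := by
      unfold dinurSafraMap
      rw [if_neg (fun h => (not_le.2 hsmall) (by simpa using h.2.1)), if_pos hfits]
    rw [h]
    refine CSPInstance.toCMMSA_mem_yesSet hwf' φ.hasArity_toCSP hsat' ?_
    calc φ.toCSP.alphabetSize ^ 2 * 2 = W ^ 2 * 2 := by simp [hW]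
      _ ≤ sqrtLog φ.numVars := pow_two_mul_two_le_sqrtLog hlt
      _ ≤ sqrtLog (φ.toCSP.numVars * φ.toCSP.litWidth) :=
          sqrtLog_mono (Nat.le_mul_of_pos_right _ φ.toCSP.one_le_litWidth)

/-- **No-instances of gap label cover with soundness error `δ ≤ (ε₀/2)(ε₀/(4g₀))²` are mapped to
no-instances of `CMMSA` with the constant gap `g₀ > 0` and soundness `ε₀ > 0`**, for
`N₀ ≥ dsThreshold W` and `δ ≤ 1`: small instances are unsatisfiable, hence sent to the fixed
no-instance; on large ones `toCMMSA_mem_noSet` (the Dinur–Safra soundness at arity `2`) applies.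
[cite: Hirahara2022PartialMCSP, proof of Thm. 5.2 (pp. 17–18, soundness), at constant g and ε] -/
theorem lcDinurSafraMap_mem_noSet (hN₀ : dsThreshold W ≤ N₀) {δ g₀ ε₀ : ℝ} (hg₀ : 0 < g₀)
    (hε₀ : 0 < ε₀) (hδ1 : δ ≤ 1) (hδ : δ ≤ ε₀ / 2 * (ε₀ / (2 * g₀ * 2)) ^ 2)
    {φ : LabelCoverInstance} (hφ : φ ∈ GapLabelCover.noSet W δ) :
    lcDinurSafraMap N₀ W φ ∈ CMMSA.noSet (fun _ => g₀) (fun _ => ε₀) sqrtLog := by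
  obtain ⟨hwf, hW, hreg, hno⟩ := hφ
  have hwf' : φ.toCSP.WellFormed := hwf.toCSP
  have hno' : ∀ a : ℕ → ℕ, (φ.toCSP.satCount a : ℝ) < δ * φ.toCSP.numConstraints := by
    simpa using hno
  unfold lcDinurSafraMap
  by_cases hsmall : φ.numVars ≤ N₀
  · have hunsat : ¬ φ.toCSP.IsSatisfiable := by
      rintro ⟨a, ha⟩
      have h1 : (φ.toCSP.satCount a : ℝ) = φ.toCSP.numConstraints := by
        exact_mod_cast (φ.toCSP.satCount_eq_numConstraints_iff a).2 ha
      have h2 := hno' a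
      rw [h1] at h2
      have hm : (0 : ℝ) ≤ φ.toCSP.numConstraints := Nat.cast_nonneg _
      have h3 : δ * φ.toCSP.numConstraints ≤ 1 * φ.toCSP.numConstraints :=
        mul_le_mul_of_nonneg_right hδ1 hm
      linarith
    have h : dinurSafraMap N₀ W φ.toCSP = trivialNoCMMSA := by
      unfold dinurSafraMap
      rw [if_pos ⟨hwf', by simpa using hsmall, by simp [hW]⟩, if_neg hunsat]
    rw [h]
    exact trivialNoCMMSA_mem_noSet hε₀
  · push Not at hsmall
    have hlt : dsThreshold W < φ.numVars := lt_of_le_of_lt hN₀ hsmall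
    have hnT : φ.toCSP.numVars ≤ φ.toCSP.totalArity := φ.numVars_le_totalArity_toCSP hwf hreg
    have hfits : φ.toCSP.numVars ≤ φ.toCSP.totalArity ∧ φ.toCSP.alphabetSize ≤ φ.toCSP.totalArity := by
      refine ⟨hnT, le_trans ?_ hnT⟩
      simpa [hW] using le_of_dsThreshold_lt hlt
    have h : dinurSafraMap N₀ W φ.toCSP = φ.toCSP.toCMMSA := by
      unfold dinurSafraMap
      rw [if_neg (fun h => (not_le.2 hsmall) (by simpa using h.2.1)), if_pos hfits]
    rw [h]
    have hdeg : φ.toCSP.alphabetSize ^ 2 * 2 ≤ sqrtLog (φ.toCSP.numVars * φ.toCSP.litWidth) :=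
      calc φ.toCSP.alphabetSize ^ 2 * 2 = W ^ 2 * 2 := by simp [hW]
        _ ≤ sqrtLog φ.numVars := pow_two_mul_two_le_sqrtLog hlt
        _ ≤ sqrtLog (φ.toCSP.numVars * φ.toCSP.litWidth) :=
            sqrtLog_mono (Nat.le_mul_of_pos_right _ φ.toCSP.one_le_litWidth)
    refine CSPInstance.toCMMSA_mem_noSet hwf' φ.hasArity_toCSP two_pos hno' hdeg hg₀ hε₀ ?_
    push_cast
    exact hδ

end Correctness

/-! ### NP-hardness of CMMSA at a constant gap -/

/-- **NP-hardness of gap label cover at soundness `δ ≤ (ε₀/2)(ε₀/(4g₀))²` gives NP-hardness of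
`gapCMMSA g₀ ε₀ sqrtLog`** (constants `g₀ ≥ 1`, `0 < ε₀ ≤ 1`): `lcDinurSafraMap (dsThreshold W) W`
is a Karp reduction of promise problems (`codeFP_lcDinurSafraMap`, `lcDinurSafraMap_mem_yesSet`,
`lcDinurSafraMap_mem_noSet`), so hardness transfers (`IsHard.of_reducible_holds`).
[cite: Hirahara2022PartialMCSP, Thm. 5.2 and its proof (pp. 16–18), at constant g and ε] -/
theorem isNPHard_gapCMMSA_const_of_gapLabelCover {W : ℕ} {δ g₀ ε₀ : ℝ} (hg₀ : 1 ≤ g₀)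
    (hε₀ : 0 < ε₀) (hε₁ : ε₀ ≤ 1) (hδ : δ ≤ ε₀ / 2 * (ε₀ / (4 * g₀)) ^ 2)
    (h : (gapLabelCover W δ).IsNPHard) :
    (gapCMMSA (fun _ => g₀) (fun _ => ε₀) sqrtLog).IsNPHard := by
  have hg₀' : 0 < g₀ := one_pos.trans_le hg₀
  -- `δ ≤ 1`
  have hδ1 : δ ≤ 1 := by
    refine hδ.trans ?_
    have h4 : ε₀ / (4 * g₀) ≤ 1 := by
      rw [div_le_one (by positivity)]
      nlinarith
    have h4' : 0 ≤ ε₀ / (4 * g₀) := by positivity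
    have hsq : (ε₀ / (4 * g₀)) ^ 2 ≤ 1 := pow_le_one₀ h4' h4
    nlinarith
  have hδ' : δ ≤ ε₀ / 2 * (ε₀ / (2 * g₀ * 2)) ^ 2 := by
    rw [show 2 * g₀ * 2 = 4 * g₀ by ring]; exact hδ
  obtain ⟨f, hf, hfφ⟩ := codeFP_lcDinurSafraMap (dsThreshold W) W
  refine PromiseProblem.IsHard.of_reducible_holds h ⟨f, hf, ?_, ?_⟩
  · intro v hv
    rw [gapLabelCover_yes] at hv
    obtain ⟨φ, hφ, rfl⟩ := hv
    rw [hfφ, gapCMMSA_yes]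
    exact Set.mem_image_of_mem _ (lcDinurSafraMap_mem_yesSet le_rfl hφ)
  · intro v hv
    rw [gapLabelCover_no] at hv
    obtain ⟨φ, hφ, rfl⟩ := hv
    rw [hfφ, gapCMMSA_no]
    exact Set.mem_image_of_mem _ (lcDinurSafraMap_mem_noSet le_rfl hg₀' hε₀ hδ1 hδ' hφ)

/-- **NP-hardness of `gapCMMSA g₀ ε₀ sqrtLog` for all constants `g₀ ≥ 1`, `0 < ε₀ ≤ 1`, from the
NP-hardness of gap label cover for every constant soundness error** (take `ε = (ε₀/2)(ε₀/(4g₀))²`).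
[cite: Hirahara2022PartialMCSP, Thm. 5.2 (proof, pp. 16–18), with AroraBarak2009, Thm. 22.15] -/
theorem isNPHard_gapCMMSA_const_of_isNPHard_gapLabelCover
    (h : ∀ ε : ℝ, 0 < ε → ∃ W : ℕ, (gapLabelCover W ε).IsNPHard) {g₀ ε₀ : ℝ} (hg₀ : 1 ≤ g₀)
    (hε₀ : 0 < ε₀) (hε₁ : ε₀ ≤ 1) :
    (gapCMMSA (fun _ => g₀) (fun _ => ε₀) sqrtLog).IsNPHard := by
  have hg₀' : 0 < g₀ := one_pos.trans_le hg₀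
  obtain ⟨W, hW⟩ := h (ε₀ / 2 * (ε₀ / (4 * g₀)) ^ 2) (by positivity)
  exact isNPHard_gapCMMSA_const_of_gapLabelCover hg₀ hε₀ hε₁ le_rfl hW

/-- **Raz's theorem in the form of Arora–Barak 2009, Thm. 22.15, gives NP-hard gap label cover at
every constant soundness error `ε > 0`** (choose `t` with `2^{-t} ≤ ε` and enlarge the no-part,
`PolyTimeReducible.gapLabelCover_mono`; the computation of `AroraEtAl1997_prop6_of_raz`).
[cite: AroraBarak2009, Thm. 22.15 (p. 473)] -/
theorem isNPHard_gapLabelCover_of_raz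
    (h : ∃ c : ℕ, 1 < c ∧ ∀ t : ℕ, 1 < t → (gapLabelCover (2 ^ (c * t)) (1 / 2 ^ t)).IsNPHard)
    (ε : ℝ) (hε : 0 < ε) : ∃ W : ℕ, (gapLabelCover W ε).IsNPHard := by
  obtain ⟨c, -, hct⟩ := h
  obtain ⟨t, ht1, htε⟩ : ∃ t : ℕ, 1 < t ∧ (1 : ℝ) / 2 ^ t ≤ ε := by
    obtain ⟨n, hn⟩ := exists_pow_lt_of_lt_one hε (by norm_num : (1 / 2 : ℝ) < 1)
    refine ⟨n + 2, by omega, le_trans ?_ hn.le⟩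
    rw [div_pow, one_pow]
    gcongr
    · norm_num
    · omega
  exact ⟨2 ^ (c * t), fun L hL => (hct t ht1 L hL).gapLabelCover_mono htε⟩

/-- **NP-hardness of `gapCMMSA g₀ ε₀ sqrtLog` (`g₀ ≥ 1`, `0 < ε₀ ≤ 1`) from Raz's theorem**
(Arora–Barak 2009, Thm. 22.15, as an explicit hypothesis). [cite: Hirahara2022PartialMCSP, Thm. 5.2 (proof, pp. 16–18), with AroraBarak2009, Thm. 22.15] -/
theorem isNPHard_gapCMMSA_const_of_raz
    (h : ∃ c : ℕ, 1 < c ∧ ∀ t : ℕ, 1 < t → (gapLabelCover (2 ^ (c * t)) (1 / 2 ^ t)).IsNPHard)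
    {g₀ ε₀ : ℝ} (hg₀ : 1 ≤ g₀) (hε₀ : 0 < ε₀) (hε₁ : ε₀ ≤ 1) :
    (gapCMMSA (fun _ => g₀) (fun _ => ε₀) sqrtLog).IsNPHard :=
  isNPHard_gapCMMSA_const_of_isNPHard_gapLabelCover (isNPHard_gapLabelCover_of_raz h) hg₀ hε₀ hε₁

/-! ### `MCSP*` from gap label cover and Lemma 8.3 at a constant gap -/

/-- **`MCSP*` is NP-hard under randomized polynomial-time reductions, from (i) the NP-hardness of
gap label cover for every constant soundness error and (ii) Hirahara's Lemma 8.3 / Thm. 8.5 at a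
constant gap**: (ii) is the statement that for some constants `g₀ ≥ 1` and `0 < ε₀ ≤ 1` the gap
problem `gapCMMSA g₀ ε₀ sqrtLog` (yes: a weight-`≤ s` assignment satisfies all formulas; no: every
weight-`≤ g₀ s` assignment satisfies fewer than `ε₀ m` of them; degree `≤ (log n)^{1/2}`) reduces to
`MCSP*` by a randomized polynomial-time many-one reduction (`PromiseRandReducible`) — the proof of
Thm. 8.5 (p. 31: "`s · g ≤ K(y) ≤ O(s' log s')`, which implies `s' ≥ Ω(g) · s / log s`" versus
`s_P = O(s / log s)`) needs `g` above a universal constant only, and the tree's `HiraharaSpec.lean`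
(`HiraharaRed.card_redOut_mem_mul_three_le`, `redOut_mem_of_yes`) establishes it mathematically
with `g₀ = 107520`. Assembly: `isNPHard_gapCMMSA_const_of_isNPHard_gapLabelCover` and
`IsRandNPHard.of_isNPHard_promise`. [cite: Hirahara2022PartialMCSP, proof of Thm. 8.5 (pp. 30–31) with Thm. 5.2; AroraBarak2009, Thm. 22.15 and §7.6] -/
theorem isRandNPHard_MCSPStar_of_gapLabelCover
    (h : ∀ ε : ℝ, 0 < ε → ∃ W : ℕ, (gapLabelCover W ε).IsNPHard)
    (h83 : ∃ g₀ ε₀ : ℝ, 1 ≤ g₀ ∧ 0 < ε₀ ∧ ε₀ ≤ 1 ∧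
      PromiseRandReducible (gapCMMSA (fun _ => g₀) (fun _ => ε₀) sqrtLog)
        (PromiseProblem.ofLanguage MCSPStar)) :
    isRandNPHard_MCSPStar := by
  obtain ⟨g₀, ε₀, hg₀, hε₀, hε₁, hred⟩ := h83
  exact IsRandNPHard.of_isNPHard_promise
    (isNPHard_gapCMMSA_const_of_isNPHard_gapLabelCover h hg₀ hε₀ hε₁) hred

/-- **`MCSP*` is NP-hard under randomized polynomial-time reductions, from Raz's theorem
(Arora–Barak 2009, Thm. 22.15) and Hirahara's Lemma 8.3 / Thm. 8.5 at a constant gap.**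
[cite: Hirahara2022PartialMCSP, Thm. 8.5 (proof, pp. 30–31); AroraBarak2009, Thm. 22.15 (p. 473)] -/
theorem isRandNPHard_MCSPStar_of_raz
    (hraz : ∃ c : ℕ, 1 < c ∧ ∀ t : ℕ, 1 < t → (gapLabelCover (2 ^ (c * t)) (1 / 2 ^ t)).IsNPHard)
    (h83 : ∃ g₀ ε₀ : ℝ, 1 ≤ g₀ ∧ 0 < ε₀ ∧ ε₀ ≤ 1 ∧
      PromiseRandReducible (gapCMMSA (fun _ => g₀) (fun _ => ε₀) sqrtLog)
        (PromiseProblem.ofLanguage MCSPStar)) :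
    isRandNPHard_MCSPStar :=
  isRandNPHard_MCSPStar_of_gapLabelCover (isNPHard_gapLabelCover_of_raz hraz) h83

/-- The randomized NP-completeness of `MCSP*` (`IsRandComplete NP MCSPStar`) from the same two
hypotheses (`MCSP* ∈ NP` is `MetaComplexity.MCSPStar_mem_NP_holds`). [cite: Hirahara2022PartialMCSP, Thm. 8.5 and §1.2 ("MCSP* ∈ NP"); AroraBarak2009, Thm. 22.15] -/
theorem isRandComplete_NP_MCSPStar_of_raz
    (hraz : ∃ c : ℕ, 1 < c ∧ ∀ t : ℕ, 1 < t → (gapLabelCover (2 ^ (c * t)) (1 / 2 ^ t)).IsNPHard)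
    (h83 : ∃ g₀ ε₀ : ℝ, 1 ≤ g₀ ∧ 0 < ε₀ ∧ ε₀ ≤ 1 ∧
      PromiseRandReducible (gapCMMSA (fun _ => g₀) (fun _ => ε₀) sqrtLog)
        (PromiseProblem.ofLanguage MCSPStar)) :
    IsRandComplete Nondeterministic.NP MCSPStar :=
  isRandComplete_NP_MCSPStar_of_isRandNPHard (isRandNPHard_MCSPStar_of_raz hraz h83)

/-- **`MCSP* ∈ BPP ⇒ NP ⊆ BPP` from the same two hypotheses** (the reduction being a
`PromiseRandReducible` one from a Karp-NP-hard promise problem,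
`NP_subset_BPP_of_MCSPStar_mem_BPP_of_promiseRandReducible`). [cite: Hirahara2022PartialMCSP, Thm. 1.2 (p. 5); AroraBarak2009, Thm. 22.15 and §7.6] -/
theorem NP_subset_BPP_of_MCSPStar_mem_BPP_of_raz
    (hraz : ∃ c : ℕ, 1 < c ∧ ∀ t : ℕ, 1 < t → (gapLabelCover (2 ^ (c * t)) (1 / 2 ^ t)).IsNPHard)
    (h83 : ∃ g₀ ε₀ : ℝ, 1 ≤ g₀ ∧ 0 < ε₀ ∧ ε₀ ≤ 1 ∧
      PromiseRandReducible (gapCMMSA (fun _ => g₀) (fun _ => ε₀) sqrtLog)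
        (PromiseProblem.ofLanguage MCSPStar)) :
    NP_subset_BPP_of_MCSPStar_mem_BPP := by
  obtain ⟨g₀, ε₀, hg₀, hε₀, hε₁, hred⟩ := h83
  exact NP_subset_BPP_of_MCSPStar_mem_BPP_of_promiseRandReducible
    (isNPHard_gapCMMSA_const_of_raz hraz hg₀ hε₀ hε₁) hred

end Literature.Computability.Complexity
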